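import Summits.QuantumFields.BalabanUV.T4Continuum.E3Cert.E3PolyCertZ
/-! E3 certificate package `ZL2d4C0half` — module `D_basis` ((4,2,1) block, d = 4, L = 2, type A small-field hypothesis c₀ = ½ ((x_t)₀ ≥ ½ on every link), γ = 923∕1024, M = 2²¹; emitter `bal_e3_lean_emit.py` output for
`block-L2d4-su2-c0half-dyadic.json`, lane `run/shared/lean/ttrl/balaban-calc/e3/lean-draft/tree/zL2d4C0half/D_basis.lean`; TREE COPY by the substrate cell (seat p3), typer
rulings (μ3)∕(ν2) = FINAL (μ6), journal l.19196 ∕ l.20020, following the E3 PILOT's scripted road (`substrate/p3/E3-PILOT.md` §1): import prefix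
substituted and one-line docstrings added BY SCRIPT, no literal touched).  Meaning of the certificate: see `Data.lean` ∕ `Main.lean` of this package
and the checker `E3Cert/E3PolyCertZ*.lean`.  HONEST: certified computation on ONE small block — NOT Prop. (1.8), NOT an input of any NE row today,
NOT infinite volume ∕ mass gap ∕ Clay. -/
set_option maxRecDepth 200000
set_option maxHeartbeats 0
namespace E3Z
/-- E3 certificate `zL2d4C0half` component: `zL2d4C0half_basis` (lane output, transcribed verbatim; see the module docstring). -/
def zL2d4C0half_basis : List Mono := [[],[(0,1)],[(1,1)],[(2,1)],[(3,1)],[(4,1)],[(5,1)],[(6,1)],[(7,1)],[(8,1)],[(9,1)],[(10,1)],[(11,1)],[(12,1)],[(13,1)],[(14,1)],[(15,1)],[(16,1)],[(17,1)],[(18,1)],[(19,1)],[(20,1)],[(21,1)],[(22,1)],[(23,1)],[(24,1)],[(25,1)],[(26,1)],[(27,1)],[(28,1)],[(29,1)],[(30,1)],[(31,1)],[(32,1)],[(33,1)],[(34,1)],[(35,1)],[(36,1)],[(37,1)],[(38,1)],[(39,1)],[(40,1)],[(41,1)],[(42,1)],[(43,1)],[(44,1)],[(45,1)],[(46,1)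],[(47,1)],[(48,1)],[(49,1)],[(50,1)],[(51,1)],[(52,1)],[(53,1)],[(54,1)],[(55,1)],[(56,1)],[(57,1)],[(58,1)],[(59,1)],[(60,1)],[(61,1)],[(62,1)],[(63,1)],[(64,1)],[(65,1)],[(66,1)],[(67,1)]]
end E3Z
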